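import Literature.MathematicalPhysics.QuantumFieldTheory.Balaban1983to89.Beta.BalabanCompositeJets
import Literature.MathematicalPhysics.QuantumFieldTheory.Balaban1983to89.Beta.AxialDressing

/-!
# Bałaban's step jets for `j ≥ 1` and the family literal `JsBal := fun j ↦ dress (JsBal⁰ j)` (β sub-cell, an2 lineage, gen 10)

The wall statement of the β sub-cell reads `OneStepKernelFamily.D1Drift Lc (JsBal N Lc) N μ ν` — the step family
`TbalOf Lc Js j = TstepOf Lc j (Js j) = hessKer (KInvStep Lc j) (vertexOfK (KInvStep Lc j) Lc (Js j).S) (Js j).W` of an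
HONEST `Js : ℕ → JetData 3 Lc` (route (α), RULING (R29): `JsBal := fun j ↦ AxialDressing.dress (JsBal⁰ j)`).  Member `0` of
`JsBal⁰` is `BalabanStepJets.jsBal0Of` (stencil `S₀`).  THIS FILE constructs the members `j ≥ 1` — the first-order stencil family
`S_j` of the GENUINE step-`j` system on the step-`j` lattice — packages them as `JetData d Lc` with abstract second-order tables,
and writes the two family literals `JsBal0Of` / `JsBalOf` together with the closed `Π`-form of every wall member
(`TbalOf_JsBalOf`, from an2's `AxialDressing.TbalOf_dress` BY NAME).  Work-order (P3) of the lead's list (journal l.58019,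
WORK-ORDER CONFIRMATION 2026-08-19T17:11:33Z); design note X-an2-36.  v1.1 (same gen): + §8, the block-translation sockets
(St♭)/(Wt) of the two families (note X-an2-38); every v1 declaration unchanged.  v1.2 (same gen): THE (P6′) RE-WEIGHTING of `Sstep`
— the (V-H) piece gets the weight `wVH j = (Lc^j)^{2(d+2)}` (was `1`) and `wΛ j = (Lc^j)^{4(d+2)}` (was `(Lc^j)^{2(d+2)}`), `wE`
unchanged — adopting the an4 lineage's count (finding X-an4-39, journal pre-rotation l.59620) after the independent re-derivation of
note X-an2-39 (UNITS paragraph below, rewritten); body-only: every statement of every lemma is unchanged (all exponent-agnostic), no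
importer unfolds a weight; + lit2's DOCFIX-LOW D1 (docstring title of `JsBal0Of_W_translate`).

HONEST LABEL.  Construction / bookkeeping grade (M→H typing, no new mathematics).  NOTHING of `FlowStep.BetaPertH` is discharged
here; discharging it would make Bałaban's ultraviolet stability UNCONDITIONAL — a real constructive-QFT result; it is NOT the
continuum limit and NOT the Clay problem.  ABSOLUTE RULE: this file cites NOTHING; every docstring tagged [folklore] states a
definition or a lemma about definitions; 0 `Prop` mirrors; no programme-internal claim enters as a fact.

THE STEP-`j` SYSTEM (`j ≥ 1`; READING, docstring-level, never a hypothesis — as for `OneStepKernelFamily.KInvStep`).  Background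
= the minimiser of the `j`-fold composite system (fine bordered operator `𝕄_j`, packed resolvent `KInv (N := Lc^j)`, derivative
stencil `BalabanCompositeJets.Sc (j−1)` — the objects `BalabanCompositeJets.jcOf j` / `TshotOf … j` read); step field on the
step-`j` lattice (again indexed by `ℤ^{d+1}`), ONE averaging `Q_{Lc}`, resolvent `KInvStep Lc j = dec (Lc^j) (KInv (Lc^{j+1}))`.
The step-`j` bordered operator is `[[E_j″ − λ_{j+1}·Q″_{Lc}, ∓Q′ᵀ_{Lc}],[Q′_{Lc}, 0]]` (border signs per the (R26-3) adapter
`StepJetData.mfNeg`) with `E_j` the `j`-step effective action; its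
derivative along the background bond `(κ′, u′)` of the step-`j` lattice has THREE pieces (AN2 design (D-λ)(iv)):
(E‴) the value-function third jet `E_j‴[·,·,e_{(κ′,u′)}]`; (V-H) the one-step averaging field–multiplier jets — the SAME term as in
`S₀` (the step system has one averaging); (Λ) the step Lagrange stencil `−λ′_{j+1}[e_{(κ′,u′)}]·Q″_{Lc}`.
SIGN (fixed by the tree, not chosen): the typed `U = 1` system is `A″·U = 𝒬ᵀ·λ (+ gauge)`, `𝒬U = b` (`KernelSpecInstance.wH_EL`),
so the multiplier is the GRADIENT of the constrained minimum `E(b)` and the multiplier-response block of the packed resolvent is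
`wΦ = +E″`; hence `E2 j := +mmRead (Lc^j) (KInv (Lc^j))` reads `+E_j″` (the rôle of `+A″` at `j = 0`, cf. `lamCoeffOf`) and the third
jet is the derivative of an inverse, `E_j‴ = ∂(𝕄_j⁻¹)_{mm} = −(𝕄_j⁻¹ (∂𝕄_j) 𝕄_j⁻¹)_{mm}` with `∂𝕄_j` along the `ℋ`-column of the
bond `= OneStepResolventKernel.vertexOf (N := Lc^j) (Sc (j−1)) κ′ u′` (BCJ's one-shot chain-rule vertex): `e3Of j κ′ u′ :=
−mmRead (Lc^j) (KInv ∘ vertexOf (Sc (j−1)) κ′ u′ ∘ KInv)` (the rôle of `+A‴ = wilsonA` at `j = 0`).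

UNITS (v1.2; the three numerals `wE j = (Lc^j)^{3(d+2)}`, `wVH j = (Lc^j)^{2(d+2)}`, `wΛ j = (Lc^j)^{4(d+2)}`; still PROVISIONAL in
the cell's sense — a DERIVATION, now made twice independently (an4 lineage X-an4-39: typed coordinates blockwise, and calibration
against `BalabanCompositeJets.Sc_succ` + the step recursion (R1); an2 X-an2-39: the exact self-similarity below), certified only by
the future proof of (R1) against an4's `StepRecursionUpTo`; every lemma below is exponent-agnostic).  Write `M := Lc^j`,
`N′ := Lc^{j+1}`.  Conventions of the package, all tree-pinned: the field legs of `KInvStep Lc j = dec M (KInv N′)` are block-contour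
MEANS (`OneStepKernelFamily.legW = M^{−(d+2)}`), so the typed step field is `a = M⁻¹·B̃_j` with `B̃_j = M·(mean)` the level-`j` field in
level-`j` lattice units (an1's `AveragingHessianKernels` conventions: the one-step average maps `B̃_j ↦ B̃_{j+1}`, its jets `vhS`,
`hessFF` are taken w.r.t. unit one-forms on the lattice they live on); its multiplier legs are those of `KInv N′`, dual to the block SUM
`b^{sum}_{j+1} = N′^{d+1}·B̃_{j+1}` (BCJ UNITS; kernel witness: `HessianTelescopingKKT.constReproSum_stepCol`, coset mass `N′^{−(d+2)}`
at step `j` versus `Lc^{−(d+2)}` at step `0`).  Hence, with `D := diag(M⁻¹ on field legs, M^{−(d+1)} on multiplier legs)`, the typed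
step Lagrangian is the ONE-STEP-NORMALISED one in rescaled coordinates, `L_j^{typ}(D ξ) = L_j^{(1)}(ξ)`, where `L_j^{(1)}` is the `j = 0`
Lagrangian written on the step-`j` lattice with the Wilson action replaced by the `j`-step effective action `E_j^{(1)}(B̃_j)`; so
`KInvStep Lc j = D K_j^{(1)} D` exactly, and by the conjugation invariance of `hessKer` (`colH (D K D) = M^{−(d+2)}·colH K`) the step
kernel `TstepOf Lc j` equals the one-step-normalised one — which (R1) demands, the `j = 0` dictionary being the base — iff
`S_j = M^{d+2}·D⁻¹ S_j^{(1)} D⁻¹` with `S_j^{(1)}` the `S₀` formula verbatim (`A″ ↦ E_j^{(1)}″`, `A‴ ↦ E_j^{(1)}‴`, `KInv Lc ↦ K_j^{(1)}`).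
Blockwise (`D⁻¹·D⁻¹` = `M²` on the field–field block, `M^{d+2}` on the field–multiplier blocks): (V-H) sits off-diagonal, an1's table
verbatim ⇒ `wVH = M^{d+2}·M^{d+2} = M^{2(d+2)}`; (E‴) is field–field and `E_j^{(1)}‴ = ∂_{B̃_j} E_j^{(1)}″ = M^{2(d+1)}·e3Of j` (`E2 j` reads
`E_j″` w.r.t. `b^{sum}_j = M^{d+1} B̃_j`; `e3Of j` is its `B̃_j`-derivative because BCJ's `Sc (j−1)` carries the accumulated `Lc^{d+1}`
per level) ⇒ `wE = M^{d+2}·M²·M^{2(d+1)} = M^{3(d+2)}`; (Λ) is field–field with `lamCoeff(K_j^{(1)}, E_j^{(1)}″) = M^{d+2}·M^{2(d+1)}·lamCoeffK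
(KInvStep Lc j) (E2 j)` (the `mf` block of `D⁻¹ KInvStep D⁻¹` and the `b^{sum}_j ↦ B̃_j` conversion of `E2`) ⇒ `wΛ = M^{d+2}·M²·M^{3d+4}
= M^{4(d+2)}`.  (v1/v1.1 had `wVH = 1`, `wΛ = M^{2(d+2)}`: the common factor `M^{d+2}` and the off-diagonal/`hessFF` block factors were
not applied to (V-H)/(Λ), and for (E‴) two slips compensated — X-an4-39 §7, conceded in X-an2-39.)  THE SAME RULE weights the
second-order tables of work-order (P4) at step `j` (first-order tables `× M^{d+1}`, second-order tables `× M^{2(d+1)}` relative to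
their typed partial derivatives, then `D⁻¹·D⁻¹` blockwise; X-an2-39 §4).  The colour weights `cE, cVH, cΛ` are the SAME real
parameters as in `S₀` (they silently contain the powers `Lc^{d+1}`, `Lc^{2(d+1)}`, `Lc^{2(d+1)}` of the first step — immaterial here,
recorded for the weight pin (P6), pinned LAST).

CONTENT (general `d`, except §7 at `d = 3`).
* §1 two composition bricks missing from `ExpKernelCalculus` §2: `decays_comp` (decaying ∘ decaying decays, rate `δ′ < δ`,
  constant `|F|·C_A·C_B·Zl(δ−δ′)`) and `biLoc_comp_right` (bi-localised ∘ decaying is bi-localised; the right twin of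
  `biLoc_comp_decays`), with their termwise bounds.
* §2 `mmRead M F` — the multiplier–multiplier block of a fine kernel read at the `M`-coarse points as a field–field kernel of the
  coarse lattice (`mmRead_eq_dec`: the same numbers as the `(inr,inr)` legs of an4's `dec M F`); `decays_mmRead`, `biLoc_mmRead`
  (rate kept: `|M•v|₁ = M|v|₁ ≥ |v|₁`), `shiftK_mmRead`.
* §3 `E2 j := mmRead (Lc^j) (KInv (Lc^j))` (`decays_E2`) and `e3Of j κ′ u′ := −mmRead (Lc^j) (KInv ∘ vertexOf (Sc (j−1)) κ′ u′ ∘ KInv)`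
  with **`locStencil_e3Of : ∃ Cs δ > 0, LocStencil (e3Of … j) Cs δ`** (`decays_KInv`, BCJ `locStencil_Sc` + `vertexFamily_vertexOf'`,
  `biLoc_comp_decays`, `biLoc_comp_right`, `biLoc_mmRead`; rate a quarter of the common rate, existential per `Lc`, `j`).
* §4 `lamCoeffK A E N μ y κ′ u′ := (A ∘ E)((N•y, inr μ); (u′, inl κ′))` — the step multiplier response through a value Hessian — and
  `abs_lamCoeffK_le` (the `hc` hypothesis of `InterLevelTransport.locStencil_SLam`, from `decays_comp`).
* §5 THE STENCIL `Sstep d Lc cE cVH cΛ j κ′ u′ := (cE·wE j) • e3Of j κ′ u′ + (cVH·wVH j) • mfNeg (vhS d Lc κ′ u′) + (cΛ·wΛ j) •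
  SLam Lc (lamCoeffK (KInvStep Lc j) (E2 j) Lc) hessFF κ′ u′` (weights `wE`/`wVH`/`wΛ`, v1.2) and **`locStencil_Sstep`** (an1's `locStencil_vhS` / `biLoc_hessFF`, an2's
  `locStencil_SLam`, `StepJetData` socket lemmas, BY NAME).
* §6 `jsStepOf hLc cE cVH cΛ W Cw δw hδw hW j : JetData d Lc` (second-order tables `W j` abstract — work-order (P4)) with `jsStepOf_S/W`;
  THE FAMILIES **`JsBal0Of … : ℕ → JetData d Lc`** (`0 ↦ jsBal0Of …`, `j+1 ↦ jsStepOf … (j+1)`; `JsBal0Of_zero/succ/S_zero/S_succ/W`)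
  and **`JsBalOf … := fun j ↦ AxialDressing.dress (JsBal0Of … j)`** — THE LITERAL OF ROUTE (α) — with `TstepOf_JsBalOf` (closed
  `Π`-form of every step kernel, `AxialDressing.TstepOf_dress` BY NAME).
* §7 (`d = 3`) **`TbalOf_JsBalOf : TbalOf Lc (JsBalOf …) j = hessKer (axDressK Lc (KInvStep Lc j)) (axVertexOfK (KInvStep Lc j) Lc
  (JsBal0Of … j).S) (W j)`** — the wall's family member by member (`AxialDressing.TbalOf_dress`).
* §8 (v1.1) THE BLOCK-TRANSLATION SOCKETS (St♭)/(Wt).  `vertexOf_translate_block` / `vertexOfK_translate_block`: the chain-rule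
  vertex is block-covariant as soon as the stencil family is covariant under BLOCK translations `u ↦ u + N•t` — the hypothesis of
  `OneStepResolventKernel.vertexOf_translate` / `OneStepKernelFamily.vertexOfK_translate` WEAKENED from all fine `v` to `v = N•t`
  (their proofs use that instance only; the full-`v` hypothesis is false for averaging-bordered stencils — an1's
  `AveragingHessianKernels` header, `packVH_translate` «for block translations ONLY»; note X-an2-38); same six-line proofs, stated
  because `Sc`, `S0`, `Sstep` are block-covariant only.  Then `shiftK_E2` (full level-`j` invariance), `comp_sandwich_shiftK`,
  `mmRead_shiftK_smul`, **`e3Of_translate`** (all level-`j` unit translations, members `j+1`), `lamCoeffK_translate`,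
  **`Sstep_translate … (j+1) κ′ (u + (Lc:ℤ)•t) = shiftK (−((Lc:ℤ)•t)) (Sstep … (j+1) κ′ u)`**, **`JsBal0Of_S_translate`** ((St♭) for every
  member of the undressed family; member `0` by `BalabanStepJets.S0_translate`), **`JsBalOf_S_translate`** ((St♭) for the dressed family,
  `AxialDressing.dress_S` / `dressS_translate`) and **`JsBalOf_W_translate`** ((Wt) for the dressed family from (Wt) of the `W` binder,
  `AxialDressing.dress_W` / `dressW_translate`).  (St♭) is the byte shape `∀ j κ′ u t, (Js j).S κ′ (u + (Lc:ℤ)•t) = shiftK (−((Lc:ℤ)•t))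
  ((Js j).S κ′ u)`; (Wt) is `∀ j μ y ν y′ t, (Js j).W μ (y + t) ν (y′ + t) = shiftK (−((Lc:ℤ)•t)) ((Js j).W μ y ν y′)`.

WHAT IS NOT HERE: (a) the second-order tables `W j` (Wilson quartic vertex, second minimiser response, averaging third jets, the
`Λ`-piece of order two) — work-order (P4), abstract binders of `jsStepOf`/`JsBal0Of`; (b) the colour-weight pin `cE, cVH, cΛ` as
defined numbers of `N` — work-order (P6), real parameters here; (c) the certification of the two UNITS numerals — with (R1); (d) the
stripped antisymmetry of `S_j` (the analogue of BCJ's `Sc_antisymm`; it needs the `J`-symmetry of the packed resolvent, OSRK-side) and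
the REFLECTION sockets (Sr)/(Wr) (an5's `refK`/`bref`/`reflSign`, later) — the block-TRANSLATION sockets ARE here (§8, v1.1); (d′) (Wt)
of the `W` binder itself — it comes with the instantiation `W j := SecondOrderResponse.W2OfK (KInvStep Lc j) …` (work-order (P4)); (e) any identification of
`hessKer (KInvStep Lc j) …` with a finite-volume second derivative of `log Z_j` (the READING above is prose); (f) NOT continuum;
NOT Clay.

Provenance: β sub-cell an2 lineage, gen 10 (2026-08-19), over `Beta.BalabanCompositeJets` v1.5 (BCJ: `Sc`, `locStencil_Sc`,
`jcOf`), `Beta.BalabanStepJets` (`S0`, `jsBal0Of`), `Beta.OneStepKernelFamily` (an4: `dec`, `KInvStep`, `TstepOf`, `TbalOf`),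
`Beta.InterLevelTransport` (`SLam`), `Beta.AveragingHessianKernels` (an1: `vhS`, `hessFF`), `Beta.AxialDressing` v1.4 (`dress`,
`TstepOf_dress`, `TbalOf_dress`) — all BY NAME; nothing restated.
-/

noncomputable section

open Finset
open scoped BigOperators
open Literature.MathematicalPhysics.QuantumFieldTheory
open Literature.MathematicalPhysics.QuantumFieldTheory.Balaban1983to89
open Literature.MathematicalPhysics.QuantumFieldTheory.Balaban1983to89.Beta
open B12Sec2to5 (l1 l1_nonneg)
open ExpKernelCalculus (MKer Decays BiLoc VertexFamily VertexFamily₂ hessKer comp shiftK comp_shiftK Zl Zl_nonneg l1_natSmul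
  l1_sub_triangle l1_sub_symm exp_split summable_exp_shift tsum_exp_shift)
open KernelSpecInstance (wH)
open OneStepResolventKernel (Fib LocStencil JetData KInv decays_KInv shiftK_KInv decays_mono biLoc_mono wsum wsum_shift vertexOf
  vertexFamily_vertexOf')
open OneStepKernelFamily (dec legSet legPt legW KInvStep decays_KInvStep shiftK_KInvStep colH colH_translate vertexOfK TstepOf TbalOf)
open StepJetData (mfNeg mfNeg_shiftK locStencil_mfNeg locStencil_add locStencil_smul)
open AveragingHessianKernels (vhS locStencil_vhS vhS_translate hessFF biLoc_hessFF hessFF_translate ell)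
open InterLevelTransport (SLam locStencil_SLam SLam_translate)
open BalabanStepJets (S0 S0_translate jsBal0Of locStencil_mono vertexFamily₂_mono)
open BalabanCompositeJets (Sc locStencil_Sc Sc_translate)
open AxialDressing (dress dress_S dress_W dressS_translate dressW_translate axDressK axVertexOfK TstepOf_dress TbalOf_dress)

namespace Literature.MathematicalPhysics.QuantumFieldTheory.Balaban1983to89.Beta.BalabanStepJetsSucc

/-! ## §1 Two composition bricks: decaying ∘ decaying, bi-localised ∘ decaying -/

section Bricks

variable {D : ℕ} {F : Type*} [Fintype F]

/-- [folklore] Termwise bound for `comp A B` with BOTH factors decaying (rate `δ`): the summand at `y` is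
`≤ |F|·C_A·C_B·e^{−δ′|x−z|}·e^{−(δ−δ′)|x−y|}` for any `0 ≤ δ′ ≤ δ`. -/
theorem abs_compTerm_le_dd {A B : MKer D F} {CA CB δ δ' : ℝ} (hA : Decays A CA δ) (hB : Decays B CB δ) (h0 : 0 ≤ δ')
    (h1 : δ' ≤ δ) (x z : Fin D → ℤ) (a b : F) (y : Fin D → ℤ) :
    |∑ f, A x y a f * B y z f b| ≤
      (Fintype.card F : ℝ) * (CA * CB) * Real.exp (-δ' * l1 (x - z)) * Real.exp (-(δ - δ') * l1 (x - y)) := by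
  classical
  have hCC : 0 ≤ CA * CB := mul_nonneg (hA.nonneg a) (hB.nonneg a)
  have hC : ∀ f, |A x y a f * B y z f b| ≤ (CA * CB) * Real.exp (-δ' * l1 (x - z)) * Real.exp (-(δ - δ') * l1 (x - y)) := by
    intro f
    rw [abs_mul]
    have h2 := hA x y a f
    have h3 := hB y z f b
    calc |A x y a f| * |B y z f b|
        ≤ (CA * Real.exp (-δ * l1 (x - y))) * (CB * Real.exp (-δ * l1 (y - z))) :=
          mul_le_mul h2 h3 (abs_nonneg _) ((abs_nonneg _).trans h2)
      _ = (CA * CB) * (Real.exp (-δ * l1 (x - y)) * Real.exp (-δ * l1 (y - z))) := by ring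
      _ ≤ (CA * CB) * (Real.exp (-(δ - δ') * l1 (x - y)) * Real.exp (-δ' * l1 (x - z))) :=
          mul_le_mul_of_nonneg_left (exp_split h0 h1 x y z) hCC
      _ = (CA * CB) * Real.exp (-δ' * l1 (x - z)) * Real.exp (-(δ - δ') * l1 (x - y)) := by ring
  calc |∑ f, A x y a f * B y z f b| ≤ ∑ f, |A x y a f * B y z f b| := Finset.abs_sum_le_sum_abs _ _
    _ ≤ ∑ _f : F, (CA * CB) * Real.exp (-δ' * l1 (x - z)) * Real.exp (-(δ - δ') * l1 (x - y)) :=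
        Finset.sum_le_sum fun f _ => hC f
    _ = _ := by rw [Finset.sum_const, Finset.card_univ, nsmul_eq_mul]; ring

/-- [folklore] **DECAYING ∘ DECAYING DECAYS** (any smaller rate `δ′ < δ`, constant `|F|·C_A·C_B·Zl(δ−δ′)`). -/
theorem decays_comp {A B : MKer D F} {CA CB δ δ' : ℝ} (hA : Decays A CA δ) (hB : Decays B CB δ) (h0 : 0 ≤ δ')
    (h1 : δ' < δ) : Decays (comp A B) ((Fintype.card F : ℝ) * (CA * CB) * Zl D (δ - δ')) δ' := by
  intro x z a b
  unfold ExpKernelCalculus.comp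
  have hs := summable_exp_shift (show 0 < δ - δ' by linarith) x
  have hmaj := hs.mul_left ((Fintype.card F : ℝ) * (CA * CB) * Real.exp (-δ' * l1 (x - z)))
  have hb := tsum_of_norm_bounded hmaj.hasSum
    (fun y => by rw [Real.norm_eq_abs]; exact abs_compTerm_le_dd hA hB h0 h1.le x z a b y)
  rw [Real.norm_eq_abs] at hb
  refine hb.trans (le_of_eq ?_)
  rw [tsum_mul_left, tsum_exp_shift]
  ring

/-- [folklore] Termwise bound for `comp K A` with `K` bi-localised at `(p, q)` and `A` decaying (rate `δ`): the summand at `y`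
is `≤ |F|·C′·C·e^{−δ|x−p|}·e^{−δ′|z−q|}·e^{−(δ−δ′)|z−y|}`. -/
theorem abs_compTerm_le_bd {K A : MKer D F} {C C' δ δ' : ℝ} {p q : Fin D → ℤ} (hK : BiLoc K p q C' δ) (hA : Decays A C δ)
    (h0 : 0 ≤ δ') (h1 : δ' ≤ δ) (x z : Fin D → ℤ) (a b : F) (y : Fin D → ℤ) :
    |∑ f, K x y a f * A y z f b| ≤
      (Fintype.card F : ℝ) * (C' * C) * Real.exp (-δ * l1 (x - p)) * Real.exp (-δ' * l1 (z - q)) *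
        Real.exp (-(δ - δ') * l1 (z - y)) := by
  classical
  have hCC : 0 ≤ C' * C := mul_nonneg (hK.nonneg a) (hA.nonneg a)
  have hC : ∀ f, |K x y a f * A y z f b| ≤ (C' * C) * Real.exp (-δ * l1 (x - p)) * Real.exp (-δ' * l1 (z - q)) *
      Real.exp (-(δ - δ') * l1 (z - y)) := by
    intro f
    rw [abs_mul]
    have h2 := hK x y a f
    have h3 := hA y z f b
    have hsplit : Real.exp (-δ * l1 (z - y)) * Real.exp (-δ * l1 (y - q)) ≤
        Real.exp (-(δ - δ') * l1 (z - y)) * Real.exp (-δ' * l1 (z - q)) := exp_split h0 h1 z y q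
    calc |K x y a f| * |A y z f b|
        ≤ (C' * Real.exp (-δ * (l1 (x - p) + l1 (y - q)))) * (C * Real.exp (-δ * l1 (y - z))) :=
          mul_le_mul h2 h3 (abs_nonneg _) ((abs_nonneg _).trans h2)
      _ = (C' * C) * Real.exp (-δ * l1 (x - p)) * (Real.exp (-δ * l1 (z - y)) * Real.exp (-δ * l1 (y - q))) := by
          rw [show -δ * (l1 (x - p) + l1 (y - q)) = -δ * l1 (x - p) + -δ * l1 (y - q) by ring, Real.exp_add,
            l1_sub_symm y z]
          ring
      _ ≤ (C' * C) * Real.exp (-δ * l1 (x - p)) * (Real.exp (-(δ - δ') * l1 (z - y)) * Real.exp (-δ' * l1 (z - q))) :=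
          mul_le_mul_of_nonneg_left hsplit (mul_nonneg hCC (Real.exp_pos _).le)
      _ = (C' * C) * Real.exp (-δ * l1 (x - p)) * Real.exp (-δ' * l1 (z - q)) * Real.exp (-(δ - δ') * l1 (z - y)) := by
          ring
  calc |∑ f, K x y a f * A y z f b| ≤ ∑ f, |K x y a f * A y z f b| := Finset.abs_sum_le_sum_abs _ _
    _ ≤ ∑ _f : F, (C' * C) * Real.exp (-δ * l1 (x - p)) * Real.exp (-δ' * l1 (z - q)) *
          Real.exp (-(δ - δ') * l1 (z - y)) := Finset.sum_le_sum fun f _ => hC f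
    _ = _ := by rw [Finset.sum_const, Finset.card_univ, nsmul_eq_mul]; ring

/-- [folklore] **BI-LOCALISED ∘ DECAYING IS BI-LOCALISED** — the right-composition twin of `ExpKernelCalculus.biLoc_comp_decays`
(same points, any smaller rate `δ′ < δ`, constant `|F|·C′·C·Zl(δ−δ′)`). -/
theorem biLoc_comp_right {K A : MKer D F} {C C' δ δ' : ℝ} {p q : Fin D → ℤ} (hK : BiLoc K p q C' δ) (hA : Decays A C δ)
    (h0 : 0 ≤ δ') (h1 : δ' < δ) : BiLoc (comp K A) p q ((Fintype.card F : ℝ) * (C' * C) * Zl D (δ - δ')) δ' := by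
  intro x z a b
  unfold ExpKernelCalculus.comp
  have hs := summable_exp_shift (show 0 < δ - δ' by linarith) z
  have hmaj := hs.mul_left ((Fintype.card F : ℝ) * (C' * C) * Real.exp (-δ * l1 (x - p)) * Real.exp (-δ' * l1 (z - q)))
  have hb := tsum_of_norm_bounded hmaj.hasSum
    (fun y => by rw [Real.norm_eq_abs]; exact abs_compTerm_le_bd hK hA h0 h1.le x z a b y)
  rw [Real.norm_eq_abs] at hb
  refine hb.trans ?_
  rw [tsum_mul_left, tsum_exp_shift]
  have hCC : 0 ≤ (Fintype.card F : ℝ) * (C' * C) * Zl D (δ - δ') :=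
    mul_nonneg (mul_nonneg (Nat.cast_nonneg _) (mul_nonneg (hK.nonneg a) (hA.nonneg a))) (Zl_nonneg (by linarith))
  have hxp : Real.exp (-δ * l1 (x - p)) ≤ Real.exp (-δ' * l1 (x - p)) := by
    rw [Real.exp_le_exp]; nlinarith [l1_nonneg (x - p)]
  calc (Fintype.card F : ℝ) * (C' * C) * Real.exp (-δ * l1 (x - p)) * Real.exp (-δ' * l1 (z - q)) * Zl D (δ - δ')
      = ((Fintype.card F : ℝ) * (C' * C) * Zl D (δ - δ')) * (Real.exp (-δ * l1 (x - p)) * Real.exp (-δ' * l1 (z - q))) := by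
        ring
    _ ≤ ((Fintype.card F : ℝ) * (C' * C) * Zl D (δ - δ')) * (Real.exp (-δ' * l1 (x - p)) * Real.exp (-δ' * l1 (z - q))) :=
        mul_le_mul_of_nonneg_left (mul_le_mul_of_nonneg_right hxp (Real.exp_pos _).le) hCC
    _ = ((Fintype.card F : ℝ) * (C' * C) * Zl D (δ - δ')) * Real.exp (-δ' * (l1 (x - p) + l1 (z - q))) := by
        rw [show -δ' * (l1 (x - p) + l1 (z - q)) = -δ' * l1 (x - p) + -δ' * l1 (z - q) by ring, Real.exp_add]

end Bricks

/-! ## §2 Reading the multiplier–multiplier block of a fine kernel as a field–field kernel on the coarse lattice -/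

section MMRead

variable {d : ℕ}

/-- [folklore] **THE `mm`-READ**: the multiplier–multiplier block of a fine kernel `F` read at the `M`-coarse points
`(M•x′, M•z′)`, placed in the field–field slot of a kernel on the `M`-times coarser lattice (all other blocks `0`).  For the
packed resolvent `KInv (N := M)` this is the multiplier-response block `wΦ` as a bond–bond kernel of the coarse lattice
(`mmRead_eq_dec`: the same numbers as the `(inr, inr)`-legs of an4's block-contour decimation `OneStepKernelFamily.dec M`). -/
def mmRead (M : ℕ) (F : ExpKernelCalculus.MKer (d + 1) (Fib d)) : ExpKernelCalculus.MKer (d + 1) (Fib d) :=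
  fun x' z' a b =>
    match a, b with
    | Sum.inl α, Sum.inl β => F ((M : ℤ) • x') ((M : ℤ) • z') (Sum.inr α) (Sum.inr β)
    | Sum.inl _, Sum.inr _ => 0
    | Sum.inr _, Sum.inl _ => 0
    | Sum.inr _, Sum.inr _ => 0

/-- [folklore] The field–field block of the `mm`-read is the `mm`-block at the dilated points. -/
@[simp] theorem mmRead_inl_inl (M : ℕ) (F : ExpKernelCalculus.MKer (d + 1) (Fib d)) (x' z' : Fin (d + 1) → ℤ)
    (α β : Fin (d + 1)) : mmRead M F x' z' (Sum.inl α) (Sum.inl β) = F ((M : ℤ) • x') ((M : ℤ) • z') (Sum.inr α) (Sum.inr β) :=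
  rfl

/-- [folklore] The `mm`-read has no multiplier legs (left). -/
@[simp] theorem mmRead_inr_left (M : ℕ) (F : ExpKernelCalculus.MKer (d + 1) (Fib d)) (x' z' : Fin (d + 1) → ℤ)
    (μ : Fin (d + 1)) (b : Fib d) : mmRead M F x' z' (Sum.inr μ) b = 0 := by
  cases b <;> rfl

/-- [folklore] The `mm`-read has no multiplier legs (right). -/
@[simp] theorem mmRead_inr_right (M : ℕ) (F : ExpKernelCalculus.MKer (d + 1) (Fib d)) (x' z' : Fin (d + 1) → ℤ)
    (a : Fib d) (ν : Fin (d + 1)) : mmRead M F x' z' a (Sum.inr ν) = 0 := by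
  cases a <;> rfl

/-- [folklore] CONSISTENCY WITH an4's DECIMATION: the `mm`-read entries ARE the multiplier legs of `dec M F` (weight `1`, read
at the coarse points). -/
theorem mmRead_eq_dec (M : ℕ) (F : ExpKernelCalculus.MKer (d + 1) (Fib d)) (x' z' : Fin (d + 1) → ℤ) (α β : Fin (d + 1)) :
    mmRead M F x' z' (Sum.inl α) (Sum.inl β) = dec M F x' z' (Sum.inr α) (Sum.inr β) := by
  simp only [mmRead_inl_inl, dec, legSet, legW, legPt, Finset.sum_singleton, one_mul]

/-- [folklore] `|x|₁` of an `M`-dilated difference: `|M•x′ − M•z′|₁ = M·|x′ − z′|₁ ≥ |x′ − z′|₁` for `M ≥ 1`. -/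
theorem l1_sub_le_l1_smul_sub {M : ℕ} (hM : 1 ≤ M) (x' z' : Fin (d + 1) → ℤ) :
    l1 (x' - z') ≤ l1 ((M : ℤ) • x' - (M : ℤ) • z') := by
  rw [← smul_sub, l1_natSmul]
  have h1 : (1 : ℝ) ≤ M := by exact_mod_cast hM
  nlinarith [l1_nonneg (x' - z')]

/-- [folklore] The `mm`-read of a decaying kernel decays at the same rate (the dilation only helps: `M ≥ 1`). -/
theorem decays_mmRead {M : ℕ} (hM : 1 ≤ M) {F : ExpKernelCalculus.MKer (d + 1) (Fib d)} {C δ : ℝ} (hF : Decays F C δ)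
    (hδ : 0 ≤ δ) : Decays (mmRead M F) C δ := by
  have hC : 0 ≤ C := hF.nonneg (Sum.inl 0)
  intro x' z' a b
  rcases a with α | μ
  · rcases b with β | ν
    · rw [mmRead_inl_inl]
      refine (hF _ _ _ _).trans (mul_le_mul_of_nonneg_left ?_ hC)
      rw [Real.exp_le_exp]
      nlinarith [l1_sub_le_l1_smul_sub hM x' z']
    · rw [mmRead_inr_right, abs_zero]; positivity
  · rw [mmRead_inr_left, abs_zero]; positivity

/-- [folklore] The `mm`-read of a kernel bi-localised at the coarse points `(M•p′, M•q′)` is bi-localised at `(p′, q′)` on the coarse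
lattice, same constant and rate. -/
theorem biLoc_mmRead {M : ℕ} (hM : 1 ≤ M) {F : ExpKernelCalculus.MKer (d + 1) (Fib d)} {C δ : ℝ} {p' q' : Fin (d + 1) → ℤ}
    (hF : BiLoc F ((M : ℤ) • p') ((M : ℤ) • q') C δ) (hδ : 0 ≤ δ) : BiLoc (mmRead M F) p' q' C δ := by
  have hC : 0 ≤ C := hF.nonneg (Sum.inl 0)
  intro x' z' a b
  rcases a with α | μ
  · rcases b with β | ν
    · rw [mmRead_inl_inl]
      refine (hF _ _ _ _).trans (mul_le_mul_of_nonneg_left ?_ hC)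
      rw [Real.exp_le_exp]
      nlinarith [l1_sub_le_l1_smul_sub hM x' p', l1_sub_le_l1_smul_sub hM z' q']
    · rw [mmRead_inr_right, abs_zero]; positivity
  · rw [mmRead_inr_left, abs_zero]; positivity

/-- [folklore] Translation: `shiftK t (mmRead M F) = mmRead M (shiftK (M•t) F)`. -/
theorem shiftK_mmRead (M : ℕ) (F : ExpKernelCalculus.MKer (d + 1) (Fib d)) (t : Fin (d + 1) → ℤ) :
    shiftK t (mmRead M F) = mmRead M (shiftK ((M : ℤ) • t) F) := by
  funext x' z' a b
  rcases a with α | μ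
  · rcases b with β | ν
    · simp only [shiftK, mmRead_inl_inl, smul_add]
    · simp only [shiftK, mmRead_inr_right]
  · simp only [shiftK, mmRead_inr_left]

end MMRead

/-! ## §3 The value-function jets of the `j`-composite, read on the step-`j` lattice -/

section ValueJets

variable (d : ℕ) (Lc : ℕ) [NeZero Lc]

/-- [folklore] **THE VALUE-FUNCTION HESSIAN `E_j″` AS A BOND–BOND KERNEL OF THE STEP-`j` LATTICE**:
`E2 j := mmRead (Lc^j) (KInv (N := Lc^j))` — the multiplier-response block `wΦ` of the packed resolvent of the `j`-fold
composite system, read at the coarse points.  READING (docstring-level, never a hypothesis) and SIGN: the typed `U = 1` system is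
`A″·U = 𝒬ᵀ·λ (+ gauge)`, `𝒬 U = b` (`KernelSpecInstance.wH_EL`: `A″ℋ = 𝒬ᵀ wΦ + d(…)`), so the multiplier `λ = wΦ·b` IS the
gradient of the constrained minimum `E(b) = ½⟨U_b, A″U_b⟩` and `wΦ = +E″` (the inverse of `[[H, −Qᵀ],[Q, 0]]` has `mm`-block
`+(Q H⁻¹ Qᵀ)⁻¹`); `E2 j` therefore reads `+` the second differential of the `j`-step effective action at its minimum, in the
package's typed multiplier units (UNITS in the module docstring) — the rôle the Wilson Hessian `A″` plays at `j = 0`. -/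
def E2 (j : ℕ) : ExpKernelCalculus.MKer (d + 1) (Fib d) :=
  mmRead (Lc ^ j) (KInv (N := Lc ^ j) (d := d))

/-- [folklore] **THE VALUE-FUNCTION THIRD JET `E_j‴[·,·,e_{(κ′,u′)}]` ALONG THE MINIMISER RESPONSE** to the step-`j` background
bond `(κ′, u′)`: `e3Of j κ′ u′ := mmRead (Lc^j) (KInv ∘ 𝒱_j(κ′,u′) ∘ KInv)` with `KInv = KInv (N := Lc^j)` and
`𝒱_j(κ′,u′) := OneStepResolventKernel.vertexOf (N := Lc^j) (Sc (j−1)) κ′ u′` — BCJ's one-shot chain-rule vertex of the `j`-fold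
composite stencil (the derivative of the fine bordered operator `𝕄_j` along the `ℋ`-column of the bond), with the SIGN of the
derivative of an inverse: `E_j‴ = ∂(𝕄_j⁻¹)_{mm} = −(𝕄_j⁻¹ (∂𝕄_j) 𝕄_j⁻¹)_{mm}` (`E_j″ = +(𝕄_j⁻¹)_{mm}`, see `E2`) — the rôle the
Wilson cubic vertex `A‴ = ∂A″` (`StepJetData.wilsonA`) plays at `j = 0`. -/
def e3Of (cE cVH cΛ : ℝ) (j : ℕ) : Fin (d + 1) → (Fin (d + 1) → ℤ) → ExpKernelCalculus.MKer (d + 1) (Fib d) :=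
  fun κ' u' x' z' a b =>
    -(mmRead (Lc ^ j)
      (comp (comp (KInv (N := Lc ^ j) (d := d)) (vertexOf (N := Lc ^ j) (Sc d Lc cE cVH cΛ (j - 1)) κ' u'))
        (KInv (N := Lc ^ j) (d := d))) x' z' a b)

variable {d Lc}

/-- [folklore] `1 ≤ Lc^j` for a nonzero blocking factor. -/
theorem one_le_pow_Lc (j : ℕ) : 1 ≤ Lc ^ j := Nat.one_le_iff_ne_zero.2 (pow_ne_zero _ (NeZero.ne Lc))

/-- [folklore] `E2 j` decays exponentially on the step-`j` lattice. -/
theorem decays_E2 (j : ℕ) : ∃ δ C : ℝ, 0 < δ ∧ 0 ≤ C ∧ Decays (E2 d Lc j) C δ := by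
  obtain ⟨δ, C, hδ, hC, hK⟩ := decays_KInv (N := Lc ^ j) (d := d)
  exact ⟨δ, C, hδ, hC, decays_mmRead (one_le_pow_Lc j) hK hδ.le⟩

/-- [folklore] **`e3Of j` IS A LOCAL STENCIL FAMILY** on the step-`j` lattice: two compositions of the decaying `KInv (Lc^j)` with
BCJ's bi-localised one-shot vertex (`vertexFamily_vertexOf'` on `locStencil_Sc`), then the `mm`-read (rates: a quarter of the
common rate; existential per `Lc`, `j`). -/
theorem locStencil_e3Of (hLc : 1 ≤ Lc) (cE cVH cΛ : ℝ) (j : ℕ) :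
    ∃ Cs δ : ℝ, 0 < δ ∧ LocStencil (e3Of d Lc cE cVH cΛ j) Cs δ := by
  obtain ⟨δK, CK, hδK, hCK, hK⟩ := decays_KInv (N := Lc ^ j) (d := d)
  obtain ⟨Cs, δs, hδs, hS⟩ := locStencil_Sc (d := d) (Lc := Lc) hLc cE cVH cΛ (j - 1)
  obtain ⟨Cv, δv, hδv, hV⟩ := vertexFamily_vertexOf' (N := Lc ^ j) hS hδs
  set m : ℝ := min δK δv with hm
  have hm0 : 0 < m := lt_min hδK hδv
  have hCv : 0 ≤ Cv := (hV 0 0).nonneg (Sum.inl 0)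
  have hKm : Decays (KInv (N := Lc ^ j) (d := d)) CK m := decays_mono hK hCK le_rfl (min_le_left _ _)
  have hKm2 : Decays (KInv (N := Lc ^ j) (d := d)) CK (m / 2) := decays_mono hK hCK le_rfl (by linarith [min_le_left δK δv])
  refine ⟨(Fintype.card (Fib d) : ℝ) * (((Fintype.card (Fib d) : ℝ) * (CK * Cv) * Zl (d + 1) (m - m / 2)) * CK) *
      Zl (d + 1) (m / 2 - m / 4), m / 4, by positivity, fun κ' u' => ?_⟩
  have hVm : BiLoc (vertexOf (N := Lc ^ j) (Sc d Lc cE cVH cΛ (j - 1)) κ' u') ((((Lc ^ j : ℕ) : ℤ)) • u')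
      ((((Lc ^ j : ℕ) : ℤ)) • u') Cv m := biLoc_mono (hV κ' u') hCv (min_le_right _ _)
  have h1 := ExpKernelCalculus.biLoc_comp_decays hKm hVm (show 0 ≤ m / 2 by positivity) (by linarith)
  have h2 := biLoc_comp_right h1 hKm2 (show 0 ≤ m / 4 by positivity) (by linarith)
  intro x' z' a b
  rw [show e3Of d Lc cE cVH cΛ j κ' u' x' z' a b = -(mmRead (Lc ^ j)
      (comp (comp (KInv (N := Lc ^ j) (d := d)) (vertexOf (N := Lc ^ j) (Sc d Lc cE cVH cΛ (j - 1)) κ' u'))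
        (KInv (N := Lc ^ j) (d := d))) x' z' a b) from rfl, abs_neg]
  exact biLoc_mmRead (one_le_pow_Lc j) h2 (by positivity) x' z' a b

end ValueJets

/-! ## §4 The multiplier response of the step system through its value Hessian: the conversion coefficients of `S^Λ` -/

section Lagrange

variable {d : ℕ}

/-- [folklore] **THE MULTIPLIER RESPONSE OF THE STEP SYSTEM**: `lamCoeffK A E N μ y κ′ u′ := (A ∘ E)((N•y, inr μ); (u′, inl κ′))`
— the first-order response `Λ′[e_{(κ′,u′)}](μ, y)` of the step multiplier at the coarse bond `(μ, y)` to the background bond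
`(κ′, u′)`, read off the differentiated stationarity equation `E″·(δ background) = Q′ᵀ·Λ′` through the multiplier–field block of the
step resolvent `A` (for the step-`j` system: `A = KInvStep Lc j`, `E = E2 j`; at `j = 0`, where `E_0″` is the Wilson Hessian and
`KInvStep Lc 0 = KInv Lc` (`HessianTelescopingKKT.kInvStep_zero`), this is `BalabanStepJets.lamCoeffOf (KInv Lc) Lc` with the
finite-range `elCol` in place of the kernel `E`). -/
def lamCoeffK (A E : ExpKernelCalculus.MKer (d + 1) (Fib d)) (N : ℕ) (μ : Fin (d + 1)) (y : Fin (d + 1) → ℤ)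
    (κ' : Fin (d + 1)) (u' : Fin (d + 1) → ℤ) : ℝ :=
  comp A E ((N : ℤ) • y) u' (Sum.inr μ) (Sum.inl κ')

/-- [folklore] **THE CONVERSION COEFFICIENTS DECAY** from the coarse bond (fine units, half the common rate of `A` and `E`) —
the `hc` hypothesis of `InterLevelTransport.locStencil_SLam`. -/
theorem abs_lamCoeffK_le {A E : ExpKernelCalculus.MKer (d + 1) (Fib d)} {CA CE δ : ℝ} (hA : Decays A CA δ) (hE : Decays E CE δ)
    (hδ : 0 < δ) (N : ℕ) (μ : Fin (d + 1)) (y : Fin (d + 1) → ℤ) (κ' : Fin (d + 1)) (u' : Fin (d + 1) → ℤ) :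
    |lamCoeffK A E N μ y κ' u'| ≤
      ((Fintype.card (Fib d) : ℝ) * (CA * CE) * Zl (d + 1) (δ - δ / 2)) * Real.exp (-(δ / 2) * l1 ((N : ℤ) • y - u')) :=
  decays_comp hA hE (show (0 : ℝ) ≤ δ / 2 by positivity) (by linarith) _ _ _ _

end Lagrange

/-! ## §5 Bałaban's step-`j` first-order stencil family, `j ≥ 1` -/

section Step

variable (d : ℕ) (Lc : ℕ) [NeZero Lc]

/-- [folklore] WEIGHT of the `E‴` piece at step `j`: `(Lc^j)^{3(d+2)}` (UNITS in the module docstring; PROVISIONAL numeral). -/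
def wE (j : ℕ) : ℝ := ((Lc : ℝ) ^ j) ^ (3 * (d + 2))

/-- [folklore] WEIGHT of the (V-H) piece at step `j`: `(Lc^j)^{2(d+2)}` (v1.2; UNITS in the module docstring; PROVISIONAL numeral). -/
def wVH (j : ℕ) : ℝ := ((Lc : ℝ) ^ j) ^ (2 * (d + 2))

/-- [folklore] WEIGHT of the `Λ` piece at step `j`: `(Lc^j)^{4(d+2)}` (v1.2, was `(Lc^j)^{2(d+2)}`; UNITS in the module docstring;
PROVISIONAL numeral). -/
def wΛ (j : ℕ) : ℝ := ((Lc : ℝ) ^ j) ^ (4 * (d + 2))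

/-- [folklore] **BAŁABAN'S STEP-`j` FIRST-ORDER STENCIL FAMILY** (`j ≥ 1`; colourless `hessKer` model, THE STRIPPING CONVENTION
of `StepJetData` §5; real weights `cE, cVH, cΛ` as for `S₀`, pinned elsewhere): the derivative, along the background bond `(κ′, u′)`
of the step-`j` lattice, of the step-`j` bordered operator `[[E_j″ − λ_{j+1}·Q″_{Lc}, ∓Q′ᵀ_{Lc}],[Q′_{Lc}, 0]]` (module docstring) —
`S_j κ′ u′ := (cE·wE j) • E_j‴[·,·,e_{(κ′,u′)}] + (cVH·wVH j) • mfNeg (vhS L κ′ u′) + (cΛ·wΛ j) • S^Λ_j κ′ u′` with the value-function third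
jet `e3Of j` (§3), an1's one-step field–multiplier kernel of the averaging on the step-`j` lattice (the SAME term as in `S₀`:
the step system has ONE averaging `Q_{Lc}`), and the step Lagrange stencil `S^Λ_j = SLam Lc (lamCoeffK (KInvStep Lc j) (E2 j) Lc)
hessFF` (an2's `InterLevelTransport.SLam` with an1's constraint Hessian and the step multiplier response of §4). -/
def Sstep (cE cVH cΛ : ℝ) (j : ℕ) : Fin (d + 1) → (Fin (d + 1) → ℤ) → ExpKernelCalculus.MKer (d + 1) (Fib d) := fun κ' u' =>
  (cE * wE d Lc j) • e3Of d Lc cE cVH cΛ j κ' u' + (cVH * wVH d Lc j) • mfNeg (vhS d Lc κ' u') +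
    (cΛ * wΛ d Lc j) • SLam Lc (lamCoeffK (KInvStep (d := d) Lc j) (E2 d Lc j) Lc) (fun μ y => hessFF Lc μ y) κ' u'

variable {d Lc}

/-- [folklore] **`S_j` IS A LOCAL STENCIL FAMILY** (the `loc` field of `JetData`): some rate `δ > 0` and constant `Cs` with
`LocStencil (Sstep … j) Cs δ` — from `locStencil_e3Of`, an1's `locStencil_vhS` + `locStencil_mfNeg`, and `locStencil_SLam` fed with
`abs_lamCoeffK_le` (`decays_KInvStep`, `decays_E2`) and an1's `biLoc_hessFF` (existential at fixed `Lc`, `j`; no uniformity claimed). -/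
theorem locStencil_Sstep (hLc : 1 ≤ Lc) (cE cVH cΛ : ℝ) (j : ℕ) :
    ∃ Cs δ : ℝ, 0 < δ ∧ LocStencil (Sstep d Lc cE cVH cΛ j) Cs δ := by
  obtain ⟨C₁, δ₁, hδ₁, h1⟩ := locStencil_e3Of (d := d) (Lc := Lc) hLc cE cVH cΛ j
  obtain ⟨δA, CA, hδA, hCA, hA⟩ := decays_KInvStep (Lc := Lc) (d := d) j
  obtain ⟨δE, CE, hδE, hCE, hE⟩ := decays_E2 (d := d) (Lc := Lc) j
  set n : ℝ := min δA δE with hn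
  have hn0 : 0 < n := lt_min hδA hδE
  have hA' : Decays (KInvStep (d := d) Lc j) CA n := decays_mono hA hCA le_rfl (min_le_left _ _)
  have hE' : Decays (E2 d Lc j) CE n := decays_mono hE hCE le_rfl (min_le_right _ _)
  have hc := abs_lamCoeffK_le hA' hE' hn0 Lc
  have hn2 : (0 : ℝ) ≤ n / 2 := by positivity
  have hQ : VertexFamily (fun μ y => hessFF (d := d) Lc μ y) Lc
      (2 * (ell (d + 1) Lc : ℝ) ^ 2 * Real.exp (4 * ((d : ℝ) + 1) * Lc * (n / 2))) (n / 2) :=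
    fun μ y => biLoc_hessFF hLc μ y hn2
  have h3 := locStencil_SLam (N := Lc) hc hQ (by positivity)
    (mul_nonneg (mul_nonneg (Nat.cast_nonneg _) (mul_nonneg hCA hCE)) (Zl_nonneg (by linarith)))
  set r : ℝ := min δ₁ (n / 2 / 2) with hr
  have hr0 : 0 < r := lt_min hδ₁ (by positivity)
  have hC₁ : 0 ≤ C₁ := (h1 0 0).nonneg (Sum.inl 0)
  have h1r : LocStencil (e3Of d Lc cE cVH cΛ j) C₁ r := locStencil_mono h1 hC₁ (min_le_left _ _)
  have h2r : LocStencil (fun κ' u => mfNeg (vhS d Lc κ' u))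
      (3 * (ell (d + 1) Lc : ℝ) ^ 2 * Real.exp (4 * ((d : ℝ) + 1) * Lc * r)) r :=
    locStencil_mfNeg (locStencil_vhS hLc hr0.le)
  have h3r := locStencil_mono h3 ((h3 0 0).nonneg (Sum.inl 0)) (min_le_right δ₁ (n / 2 / 2))
  exact ⟨_, r, hr0, locStencil_add (locStencil_add (locStencil_smul (cE * wE d Lc j) h1r) (locStencil_smul (cVH * wVH d Lc j) h2r))
    (locStencil_smul (cΛ * wΛ d Lc j) h3r)⟩

end Step

/-! ## §6 The step-`j` jet datum and THE FAMILIES `JsBal⁰`, `JsBal` -/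

section Family

variable {d : ℕ} {Lc : ℕ} [NeZero Lc]

/-- [folklore] **THE STEP-`j` JET DATUM WITH FIRST-ORDER PART `S_j`** (`j ≥ 1` intended): for any family of second-order vertex
families `W j` bi-localised at the coarse bonds of the step-`j` lattice (rate `δw j > 0`; Bałaban's second-order tables, abstract
here — work-order (P4)) the pair `(S_j, W j)` is a `JetData d Lc`, so `OneStepKernelFamily.TstepOf Lc j (jsStepOf … j)` is a typed
step-`j` kernel and every socket lemma applies BY NAME. -/
def jsStepOf (hLc : 1 ≤ Lc) (cE cVH cΛ : ℝ)
    (W : ℕ → Fin (d + 1) → (Fin (d + 1) → ℤ) → Fin (d + 1) → (Fin (d + 1) → ℤ) → ExpKernelCalculus.MKer (d + 1) (Fib d))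
    (Cw δw : ℕ → ℝ) (hδw : ∀ j, 0 < δw j) (hW : ∀ j, VertexFamily₂ (W j) Lc (Cw j) (δw j)) (j : ℕ) : JetData d Lc :=
  have hS := locStencil_Sstep (d := d) (Lc := Lc) hLc cE cVH cΛ j
  have hδS : 0 < hS.choose_spec.choose := hS.choose_spec.choose_spec.1
  have hloc : LocStencil (Sstep d Lc cE cVH cΛ j) hS.choose hS.choose_spec.choose := hS.choose_spec.choose_spec.2
  { S := Sstep d Lc cE cVH cΛ j
    W := W j
    Cs := hS.choose
    Cw := Cw j
    δ := min hS.choose_spec.choose (δw j)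
    δ_pos := lt_min hδS (hδw j)
    loc := locStencil_mono hloc ((hloc 0 0).nonneg (Sum.inl 0)) (min_le_left _ _)
    loc₂ := vertexFamily₂_mono (hW j) ((hW j 0 0 0 0).nonneg (Sum.inl 0)) (min_le_right _ _) }

/-- [folklore] The first-order part of the step-`j` datum is `S_j`. -/
@[simp] theorem jsStepOf_S (hLc : 1 ≤ Lc) (cE cVH cΛ : ℝ)
    (W : ℕ → Fin (d + 1) → (Fin (d + 1) → ℤ) → Fin (d + 1) → (Fin (d + 1) → ℤ) → ExpKernelCalculus.MKer (d + 1) (Fib d))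
    (Cw δw : ℕ → ℝ) (hδw : ∀ j, 0 < δw j) (hW : ∀ j, VertexFamily₂ (W j) Lc (Cw j) (δw j)) (j : ℕ) :
    (jsStepOf hLc cE cVH cΛ W Cw δw hδw hW j).S = Sstep d Lc cE cVH cΛ j := rfl

/-- [folklore] The second-order part of the step-`j` datum is the given `W j`. -/
@[simp] theorem jsStepOf_W (hLc : 1 ≤ Lc) (cE cVH cΛ : ℝ)
    (W : ℕ → Fin (d + 1) → (Fin (d + 1) → ℤ) → Fin (d + 1) → (Fin (d + 1) → ℤ) → ExpKernelCalculus.MKer (d + 1) (Fib d))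
    (Cw δw : ℕ → ℝ) (hδw : ∀ j, 0 < δw j) (hW : ∀ j, VertexFamily₂ (W j) Lc (Cw j) (δw j)) (j : ℕ) :
    (jsStepOf hLc cE cVH cΛ W Cw δw hδw hW j).W = W j := rfl

/-- [folklore] **THE UNDRESSED FAMILY `JsBal⁰`** of Bałaban's step jets: member `0` is `BalabanStepJets.jsBal0Of` (stencil `S₀`:
Wilson cubic vertex, one-step border, Lagrange stencil through the Wilson Hessian), member `j+1` is `jsStepOf … (j+1)` (stencil
`S_{j+1}`: value-function third jet of the `(j+1)`-composite, one-step border, Lagrange stencil through `E_{j+1}″`); second-order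
tables `W j` abstract (work-order (P4)); colour weights `cE, cVH, cΛ` real parameters (pinned LAST, work-order (P6)). -/
def JsBal0Of (hLc : 1 ≤ Lc) (cE cVH cΛ : ℝ)
    (W : ℕ → Fin (d + 1) → (Fin (d + 1) → ℤ) → Fin (d + 1) → (Fin (d + 1) → ℤ) → ExpKernelCalculus.MKer (d + 1) (Fib d))
    (Cw δw : ℕ → ℝ) (hδw : ∀ j, 0 < δw j) (hW : ∀ j, VertexFamily₂ (W j) Lc (Cw j) (δw j)) : ℕ → JetData d Lc
  | 0 => jsBal0Of hLc cE cVH cΛ (W 0) (Cw 0) (δw 0) (hδw 0) (hW 0)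
  | j + 1 => jsStepOf hLc cE cVH cΛ W Cw δw hδw hW (j + 1)

/-- [folklore] **THE DRESSED FAMILY `JsBal`** — THE LITERAL OF ROUTE (α) (RULING (R29)): `JsBal := fun j ↦ AxialDressing.dress
(JsBal⁰ j)`, the axial-gauge dressing `Πᵀ` applied ONCE per jet datum. -/
def JsBalOf (hLc : 1 ≤ Lc) (cE cVH cΛ : ℝ)
    (W : ℕ → Fin (d + 1) → (Fin (d + 1) → ℤ) → Fin (d + 1) → (Fin (d + 1) → ℤ) → ExpKernelCalculus.MKer (d + 1) (Fib d))
    (Cw δw : ℕ → ℝ) (hδw : ∀ j, 0 < δw j) (hW : ∀ j, VertexFamily₂ (W j) Lc (Cw j) (δw j)) : ℕ → JetData d Lc :=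
  fun j => dress (JsBal0Of hLc cE cVH cΛ W Cw δw hδw hW j)

variable (hLc : 1 ≤ Lc) (cE cVH cΛ : ℝ)
    (W : ℕ → Fin (d + 1) → (Fin (d + 1) → ℤ) → Fin (d + 1) → (Fin (d + 1) → ℤ) → ExpKernelCalculus.MKer (d + 1) (Fib d))
    (Cw δw : ℕ → ℝ) (hδw : ∀ j, 0 < δw j) (hW : ∀ j, VertexFamily₂ (W j) Lc (Cw j) (δw j))

/-- [folklore] Member `0` of `JsBal⁰` is the `j = 0` datum of `BalabanStepJets`. -/
theorem JsBal0Of_zero : JsBal0Of hLc cE cVH cΛ W Cw δw hδw hW 0 = jsBal0Of hLc cE cVH cΛ (W 0) (Cw 0) (δw 0) (hδw 0) (hW 0) := rfl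

/-- [folklore] Member `j+1` of `JsBal⁰` is the step-`(j+1)` datum. -/
theorem JsBal0Of_succ (j : ℕ) : JsBal0Of hLc cE cVH cΛ W Cw δw hδw hW (j + 1) = jsStepOf hLc cE cVH cΛ W Cw δw hδw hW (j + 1) :=
  rfl

/-- [folklore] The stencil of member `0` is `S₀`. -/
@[simp] theorem JsBal0Of_S_zero : (JsBal0Of hLc cE cVH cΛ W Cw δw hδw hW 0).S = S0 d Lc cE cVH cΛ := rfl

/-- [folklore] The stencil of member `j+1` is `S_{j+1}`. -/
@[simp] theorem JsBal0Of_S_succ (j : ℕ) : (JsBal0Of hLc cE cVH cΛ W Cw δw hδw hW (j + 1)).S = Sstep d Lc cE cVH cΛ (j + 1) := rfl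

/-- [folklore] The second-order tables of `JsBal⁰` are the given ones, member by member. -/
@[simp] theorem JsBal0Of_W : ∀ j : ℕ, (JsBal0Of hLc cE cVH cΛ W Cw δw hδw hW j).W = W j
  | 0 => rfl
  | _ + 1 => rfl

/-- [folklore] `JsBal` is `dress ∘ JsBal⁰`, by definition. -/
theorem JsBalOf_apply (j : ℕ) : JsBalOf hLc cE cVH cΛ W Cw δw hδw hW j = dress (JsBal0Of hLc cE cVH cΛ W Cw δw hδw hW j) := rfl

/-- [folklore] **THE STEP KERNELS OF THE DRESSED FAMILY IN CLOSED `Π`-FORM** (an2 `AxialDressing.TstepOf_dress`, BY NAME): for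
every `j`, `TstepOf Lc j (JsBal j) = hessKer (Π·KInvStep Lc j·Π) (V^Π_{KInvStep Lc j} (JsBal⁰ j).S) (W j)`. -/
theorem TstepOf_JsBalOf (j : ℕ) :
    TstepOf Lc j (JsBalOf hLc cE cVH cΛ W Cw δw hδw hW j)
      = hessKer (axDressK Lc (KInvStep (d := d) Lc j))
          (axVertexOfK (KInvStep (d := d) Lc j) Lc (JsBal0Of hLc cE cVH cΛ W Cw δw hδw hW j).S) (W j) := by
  rw [JsBalOf_apply, TstepOf_dress, JsBal0Of_W]

end Family

section Wall

variable {Lc : ℕ} [NeZero Lc] (hLc : 1 ≤ Lc) (cE cVH cΛ : ℝ)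
    (W : ℕ → Fin (3 + 1) → (Fin (3 + 1) → ℤ) → Fin (3 + 1) → (Fin (3 + 1) → ℤ) → ExpKernelCalculus.MKer (3 + 1) (Fib 3))
    (Cw δw : ℕ → ℝ) (hδw : ∀ j, 0 < δw j) (hW : ∀ j, VertexFamily₂ (W j) Lc (Cw j) (δw j))

/-- [folklore] **THE WALL'S FAMILY, MEMBER BY MEMBER** (dimension four, `d = 3`): `OneStepKernelFamily.TbalOf Lc JsBal j` in
closed `Π`-form (an2 `AxialDressing.TbalOf_dress`, BY NAME) — the object `OneStepKernelFamily.D1Drift Lc JsBal N μ ν` reads. -/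
theorem TbalOf_JsBalOf (j : ℕ) :
    TbalOf Lc (JsBalOf hLc cE cVH cΛ W Cw δw hδw hW) j
      = hessKer (axDressK Lc (KInvStep (d := 3) Lc j))
          (axVertexOfK (KInvStep (d := 3) Lc j) Lc (JsBal0Of hLc cE cVH cΛ W Cw δw hδw hW j).S) (W j) := by
  rw [show TbalOf Lc (JsBalOf hLc cE cVH cΛ W Cw δw hδw hW) j = TstepOf Lc j (JsBalOf hLc cE cVH cΛ W Cw δw hδw hW j)
    from rfl]
  exact TstepOf_JsBalOf hLc cE cVH cΛ W Cw δw hδw hW j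

end Wall

/-! ## §8 (v1.1) The block-translation sockets (St♭)/(Wt) of `JsBal⁰` and `JsBal` -/

section Covariance

variable {d : ℕ}

/-- [folklore] **BLOCK-COVARIANCE OF THE ONE-SHOT CHAIN-RULE VERTEX** — `OneStepResolventKernel.vertexOf_translate` with its
hypothesis WEAKENED to block translations `u ↦ u + N•t` (the only instance that proof uses; the full fine-`v` hypothesis is false for
averaging-bordered stencil families such as `S0`/`Sc`/`Sstep`). -/
theorem vertexOf_translate_block {N : ℕ} [NeZero N] {S : Fin (d + 1) → (Fin (d + 1) → ℤ) → ExpKernelCalculus.MKer (d + 1) (Fib d)}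
    (hS : ∀ (κ' : Fin (d + 1)) (u t : Fin (d + 1) → ℤ), S κ' (u + (N : ℤ) • t) = shiftK (-((N : ℤ) • t)) (S κ' u))
    (μ : Fin (d + 1)) (y t : Fin (d + 1) → ℤ) :
    vertexOf (N := N) S μ (y + t) = shiftK (-((N : ℤ) • t)) (vertexOf (N := N) S μ y) := by
  funext x z a b
  simp only [vertexOf]
  have h : ∀ κ' : Fin (d + 1), wsum (fun u => wH (N := N) κ' μ (u - (N : ℤ) • (y + t))) (S κ') =
      shiftK (-((N : ℤ) • t)) (wsum (fun u => wH (N := N) κ' μ (u - (N : ℤ) • y)) (S κ')) := by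
    intro κ'
    have hw : (fun u => wH (N := N) κ' μ (u - (N : ℤ) • (y + t))) =
        fun u => (fun u' => wH (N := N) κ' μ (u' - (N : ℤ) • y)) (u - (N : ℤ) • t) := by
      funext u
      simp only [smul_add]
      congr 1
      abel
    rw [hw]
    exact wsum_shift (fun u' => wH (N := N) κ' μ (u' - (N : ℤ) • y)) ((N : ℤ) • t) (fun u => hS κ' u t)
  simp only [h, shiftK, vertexOf]

/-- [folklore] **BLOCK-COVARIANCE OF THE CHAIN-RULE VERTEX THROUGH A BLOCK-COVARIANT KERNEL** — an4's
`OneStepKernelFamily.vertexOfK_translate` with its stencil hypothesis WEAKENED to block translations (the only instance that proof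
uses). -/
theorem vertexOfK_translate_block {N : ℕ} {K : ExpKernelCalculus.MKer (d + 1) (Fib d)} (hKs : ∀ t, shiftK (-((N : ℤ) • t)) K = K)
    {S : Fin (d + 1) → (Fin (d + 1) → ℤ) → ExpKernelCalculus.MKer (d + 1) (Fib d)}
    (hS : ∀ (κ' : Fin (d + 1)) (u t : Fin (d + 1) → ℤ), S κ' (u + (N : ℤ) • t) = shiftK (-((N : ℤ) • t)) (S κ' u))
    (μ : Fin (d + 1)) (y t : Fin (d + 1) → ℤ) :
    vertexOfK K N S μ (y + t) = shiftK (-((N : ℤ) • t)) (vertexOfK K N S μ y) := by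
  funext x z a b
  simp only [vertexOfK]
  have h : ∀ κ' : Fin (d + 1), wsum (colH K N μ (y + t) κ') (S κ') = shiftK (-((N : ℤ) • t)) (wsum (colH K N μ y κ') (S κ')) := by
    intro κ'
    have hw : colH K N μ (y + t) κ' = fun u => colH K N μ y κ' (u - (N : ℤ) • t) := funext (colH_translate hKs μ y t κ')
    rw [hw]
    exact wsum_shift (colH K N μ y κ') ((N : ℤ) • t) (fun u => hS κ' u t)
  simp only [h, shiftK, vertexOfK]

/-- [folklore] A kernel invariant under a shift sandwiches covariantly: `K ∘ shiftK s V ∘ K = shiftK s (K ∘ V ∘ K)`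
(`ExpKernelCalculus.comp_shiftK` twice). -/
theorem comp_sandwich_shiftK {D : ℕ} {F : Type*} [Fintype F] {K : ExpKernelCalculus.MKer D F} {s : Fin D → ℤ}
    (hK : shiftK s K = K) (V : ExpKernelCalculus.MKer D F) : comp (comp K (shiftK s V)) K = shiftK s (comp (comp K V) K) := by
  conv_rhs => rw [← comp_shiftK, ← comp_shiftK, hK]

/-- [folklore] `mmRead` intertwines a coarse shift with the `M`-multiple fine shift (`shiftK_mmRead`, sign-flipped form). -/
theorem mmRead_shiftK_smul (M : ℕ) (F : ExpKernelCalculus.MKer (d + 1) (Fib d)) (t : Fin (d + 1) → ℤ) :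
    mmRead M (shiftK (-((M : ℤ) • t)) F) = shiftK (-t) (mmRead M F) := by
  rw [shiftK_mmRead, smul_neg]

variable {Lc : ℕ} [NeZero Lc]

/-- [folklore] **THE VALUE HESSIAN IS TRANSLATION INVARIANT ON THE STEP-`j` LATTICE** (all unit translations):
`shiftK s (E2 j) = E2 j` (`shiftK_mmRead` + `OneStepResolventKernel.shiftK_KInv` at blocking `Lc^j`). -/
theorem shiftK_E2 (j : ℕ) (s : Fin (d + 1) → ℤ) : shiftK s (E2 d Lc j) = E2 d Lc j := by
  unfold E2
  rw [shiftK_mmRead]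
  have h := shiftK_KInv (N := Lc ^ j) (d := d) (-s)
  rw [smul_neg, neg_neg] at h
  rw [h]

/-- [folklore] **THE VALUE-FUNCTION THIRD JET IS TRANSLATION COVARIANT ON THE STEP LATTICE** (members `j+1`, all unit translations
`t′` of the step-`(j+1)` lattice): `e3Of (j+1) κ′ (u′ + t′) = shiftK (−t′) (e3Of (j+1) κ′ u′)` — from BCJ's `Sc_translate j` (block
covariance of the `(j+1)`-composite stencil at blocking `Lc^{j+1}`) through `vertexOf_translate_block`, `shiftK_KInv`,
`comp_sandwich_shiftK` and `mmRead_shiftK_smul`.  (Member `0` is a dead index of `Sstep` and is not covered.) -/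
theorem e3Of_translate (hLc : 1 ≤ Lc) (cE cVH cΛ : ℝ) (j : ℕ) (κ' : Fin (d + 1)) (u' t' : Fin (d + 1) → ℤ) :
    e3Of d Lc cE cVH cΛ (j + 1) κ' (u' + t') = shiftK (-t') (e3Of d Lc cE cVH cΛ (j + 1) κ' u') := by
  have hS : ∀ (κ : Fin (d + 1)) (u t : Fin (d + 1) → ℤ), Sc d Lc cE cVH cΛ (j + 1 - 1) κ (u + (((Lc ^ (j + 1) : ℕ) : ℤ)) • t)
      = shiftK (-((((Lc ^ (j + 1) : ℕ) : ℤ)) • t)) (Sc d Lc cE cVH cΛ (j + 1 - 1) κ u) := by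
    rw [Nat.add_sub_cancel]
    exact Sc_translate hLc cE cVH cΛ j
  have hV := vertexOf_translate_block (N := Lc ^ (j + 1)) hS κ' u' t'
  have hK := shiftK_KInv (N := Lc ^ (j + 1)) (d := d) t'
  funext x' z' a b
  simp only [e3Of, shiftK]
  rw [hV, comp_sandwich_shiftK hK, mmRead_shiftK_smul]
  rfl

/-- [folklore] **BLOCK-TRANSLATION COVARIANCE OF THE STEP CONVERSION COEFFICIENTS**: for `A`, `E` invariant under the block shifts
`shiftK (−N•t)`, `lamCoeffK A E N μ (y + t) κ′ (u′ + N•t) = lamCoeffK A E N μ y κ′ u′` (the `hc` hypothesis of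
`InterLevelTransport.SLam_translate`). -/
theorem lamCoeffK_translate {N : ℕ} {A E : ExpKernelCalculus.MKer (d + 1) (Fib d)} (hA : ∀ t : Fin (d + 1) → ℤ, shiftK (-((N : ℤ) • t)) A = A)
    (hE : ∀ t : Fin (d + 1) → ℤ, shiftK (-((N : ℤ) • t)) E = E) (μ : Fin (d + 1)) (y : Fin (d + 1) → ℤ) (κ' : Fin (d + 1))
    (u' t : Fin (d + 1) → ℤ) : lamCoeffK A E N μ (y + t) κ' (u' + (N : ℤ) • t) = lamCoeffK A E N μ y κ' u' := by
  unfold lamCoeffK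
  have e := comp_shiftK (-((N : ℤ) • t)) A E
  rw [hA t, hE t] at e
  conv_lhs => rw [e]
  simp only [shiftK]
  congr 1
  · rw [smul_add]; abel
  · abel

/-- [folklore] **(St♭) FOR THE STEP STENCILS**: `Sstep (j+1)` is covariant under the BLOCK translations `u ↦ u + Lc•t` of the step
lattice — `e3Of_translate` (at `t′ = Lc•t`), an1's `vhS_translate` through `StepJetData.mfNeg_shiftK`, and
`InterLevelTransport.SLam_translate` fed with `lamCoeffK_translate` (`OneStepKernelFamily.shiftK_KInvStep`, `shiftK_E2`) and an1's
`hessFF_translate`; exactly the shape of `BalabanStepJets.S0_translate`. -/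
theorem Sstep_translate (hLc : 1 ≤ Lc) (cE cVH cΛ : ℝ) (j : ℕ) (κ' : Fin (d + 1)) (u t : Fin (d + 1) → ℤ) :
    Sstep d Lc cE cVH cΛ (j + 1) κ' (u + (Lc : ℤ) • t) = shiftK (-((Lc : ℤ) • t)) (Sstep d Lc cE cVH cΛ (j + 1) κ' u) := by
  have h1 := e3Of_translate (d := d) hLc cE cVH cΛ j κ' u ((Lc : ℤ) • t)
  have h2 := vhS_translate (d := d) hLc κ' u t
  have h3 := SLam_translate (N := Lc) (c := lamCoeffK (KInvStep (d := d) Lc (j + 1)) (E2 d Lc (j + 1)) Lc)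
    (Q2 := fun μ y => hessFF (d := d) Lc μ y)
    (fun μ y κ'' u' t' => lamCoeffK_translate (fun s => shiftK_KInvStep (d := d) (Lc := Lc) (j + 1) s)
      (fun s => shiftK_E2 (d := d) (Lc := Lc) (j + 1) _) μ y κ'' u' t')
    (fun μ y t' => hessFF_translate μ y t') κ' u t
  funext x z a b
  simp only [Sstep, Pi.add_apply, Pi.smul_apply, smul_eq_mul, shiftK]
  rw [h1, h2, mfNeg_shiftK, h3]
  rfl

variable (hLc : 1 ≤ Lc) (cE cVH cΛ : ℝ)
    (W : ℕ → Fin (d + 1) → (Fin (d + 1) → ℤ) → Fin (d + 1) → (Fin (d + 1) → ℤ) → ExpKernelCalculus.MKer (d + 1) (Fib d))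
    (Cw δw : ℕ → ℝ) (hδw : ∀ j, 0 < δw j) (hW : ∀ j, VertexFamily₂ (W j) Lc (Cw j) (δw j))

/-- [folklore] **(St♭) FOR THE UNDRESSED FAMILY `JsBal⁰`**, every member: `(JsBal⁰ j).S κ′ (u + Lc•t) = shiftK (−Lc•t) ((JsBal⁰ j).S κ′ u)`
(`BalabanStepJets.S0_translate` for member `0`, `Sstep_translate` for members `j+1`). -/
theorem JsBal0Of_S_translate : ∀ (j : ℕ) (κ' : Fin (d + 1)) (u t : Fin (d + 1) → ℤ),
    (JsBal0Of hLc cE cVH cΛ W Cw δw hδw hW j).S κ' (u + (Lc : ℤ) • t)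
      = shiftK (-((Lc : ℤ) • t)) ((JsBal0Of hLc cE cVH cΛ W Cw δw hδw hW j).S κ' u)
  | 0, κ', u, t => by rw [JsBal0Of_S_zero]; exact S0_translate hLc cE cVH cΛ κ' u t
  | j + 1, κ', u, t => by rw [JsBal0Of_S_succ]; exact Sstep_translate hLc cE cVH cΛ j κ' u t

/-- [folklore] **(St♭) FOR THE DRESSED FAMILY `JsBal = dress ∘ JsBal⁰`**, every member — `AxialDressing.dressS_translate` over
`JsBal0Of_S_translate`. -/
theorem JsBalOf_S_translate (j : ℕ) (κ' : Fin (d + 1)) (u t : Fin (d + 1) → ℤ) :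
    (JsBalOf hLc cE cVH cΛ W Cw δw hδw hW j).S κ' (u + (Lc : ℤ) • t)
      = shiftK (-((Lc : ℤ) • t)) ((JsBalOf hLc cE cVH cΛ W Cw δw hδw hW j).S κ' u) := by
  show (dress (JsBal0Of hLc cE cVH cΛ W Cw δw hδw hW j)).S κ' (u + (Lc : ℤ) • t)
    = shiftK (-((Lc : ℤ) • t)) ((dress (JsBal0Of hLc cE cVH cΛ W Cw δw hδw hW j)).S κ' u)
  rw [dress_S, dress_S]
  exact dressS_translate hLc (JsBal0Of_S_translate hLc cE cVH cΛ W Cw δw hδw hW j) κ' u t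

/-- [folklore] **(Wt) FOR THE DRESSED FAMILY FROM (Wt) OF THE TABLES**: if every `W j` is block-covariant, so is every `(JsBal j).W`
(`AxialDressing.dressW_translate`; `(JsBal⁰ j).W = W j` by `JsBal0Of_W`). -/
theorem JsBalOf_W_translate
    (hWt : ∀ (j : ℕ) (μ : Fin (d + 1)) (y : Fin (d + 1) → ℤ) (ν : Fin (d + 1)) (y' t : Fin (d + 1) → ℤ),
      W j μ (y + t) ν (y' + t) = shiftK (-((Lc : ℤ) • t)) (W j μ y ν y'))
    (j : ℕ) (μ : Fin (d + 1)) (y : Fin (d + 1) → ℤ) (ν : Fin (d + 1)) (y' t : Fin (d + 1) → ℤ) :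
    (JsBalOf hLc cE cVH cΛ W Cw δw hδw hW j).W μ (y + t) ν (y' + t)
      = shiftK (-((Lc : ℤ) • t)) ((JsBalOf hLc cE cVH cΛ W Cw δw hδw hW j).W μ y ν y') := by
  show (dress (JsBal0Of hLc cE cVH cΛ W Cw δw hδw hW j)).W μ (y + t) ν (y' + t)
    = shiftK (-((Lc : ℤ) • t)) ((dress (JsBal0Of hLc cE cVH cΛ W Cw δw hδw hW j)).W μ y ν y')
  rw [dress_W, dress_W, JsBal0Of_W]
  exact dressW_translate hLc (hWt j) μ y ν y' t

/-- [folklore] **(Wt) FOR THE UNDRESSED FAMILY**: block covariance of `(JsBal⁰ j).W` from that of the tables (docstring title fixed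
v1.2, lit2 XREAD D1 post-rotation l.244). -/
theorem JsBal0Of_W_translate
    (hWt : ∀ (j : ℕ) (μ : Fin (d + 1)) (y : Fin (d + 1) → ℤ) (ν : Fin (d + 1)) (y' t : Fin (d + 1) → ℤ),
      W j μ (y + t) ν (y' + t) = shiftK (-((Lc : ℤ) • t)) (W j μ y ν y'))
    (j : ℕ) (μ : Fin (d + 1)) (y : Fin (d + 1) → ℤ) (ν : Fin (d + 1)) (y' t : Fin (d + 1) → ℤ) :
    (JsBal0Of hLc cE cVH cΛ W Cw δw hδw hW j).W μ (y + t) ν (y' + t)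
      = shiftK (-((Lc : ℤ) • t)) ((JsBal0Of hLc cE cVH cΛ W Cw δw hδw hW j).W μ y ν y') := by
  rw [JsBal0Of_W]
  exact hWt j μ y ν y' t

end Covariance

end Literature.MathematicalPhysics.QuantumFieldTheory.Balaban1983to89.Beta.BalabanStepJetsSucc

end
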